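import Mathlib
import Summits.Ventures.PercRepro2.TB14Fold

/-!
# Typed BHK 1.4 (single-vertex) when `o` is a leaf at `a₂`: an equality
(blind cell PercRepro2, mine-c g13, 2026-08-25; MINE-C.md §22; the pendant class of row 2′TB)

If `o` has a single edge `e₁`, joining it to `a₂`, then at every profile `N(QAB, Q) = N(QB, QA)`:
when `e₁` is free, flipping `e₁` alone is an involution of the admissible first copies that keeps
`Q` in both copies and `b ∈ C₁`, and exchanges `o ∈ C₂` between the copies, so the folded summand
of `pairCount_fold` is antisymmetric; when `e₁` is pinned, `o ∈ C₂` agrees in both copies and the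
summand vanishes.
* `conn_of_leaf_agree`: connections between vertices other than `o` do not see `e₁`;
* `conn_leaf_iff`: `a₂ ↔ o` iff `e₁` is open;
* **`tb14_of_leaf`**: the equality.
Axioms: standard.
-/

namespace Summit.Ventures.PercRepro2

namespace TB14Fold

open CovForm A3InactiveTyped

section Leaf

variable {V : Type} {E : Type} [Fintype E] [DecidableEq E]

omit [Fintype E] [DecidableEq E] in
/-- An edge at the leaf `o` is `e₁`, and its other endpoint is `a₂`. -/
lemma endpoint_of_leaf {ends : E → Sym2 V} {a₂ o : V} {e₁ : E} (h₁ : ends e₁ = s(a₂, o))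
    (hleaf : ∀ e, o ∈ ends e → e = e₁) {e : E} {w : V} (hends : ends e = s(o, w)) (hw : w ≠ o) :
    e = e₁ ∧ w = a₂ := by
  have he : e = e₁ := hleaf e (by rw [hends]; exact Sym2.mem_mk_left o w)
  subst he
  refine ⟨rfl, ?_⟩
  have : w ∈ ends e := by rw [hends]; exact Sym2.mem_mk_right o w
  rw [h₁, Sym2.mem_iff] at this
  rcases this with h | h
  · exact h
  · exact absurd h hw

omit [Fintype E] [DecidableEq E] in
/-- An edge with both endpoints different from `o` is not `e₁`. -/
lemma ne_leafEdge {ends : E → Sym2 V} {a₂ o : V} {e₁ : E} (h₁ : ends e₁ = s(a₂, o)) {e : E}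
    {x w : V} (hends : ends e = s(x, w)) (hx : x ≠ o) (hw : w ≠ o) : e ≠ e₁ := by
  intro he
  subst he
  rw [h₁] at hends
  have : o ∈ s(x, w) := by rw [← hends]; exact Sym2.mem_mk_right a₂ o
  rw [Sym2.mem_iff] at this
  rcases this with h | h
  · exact hx h.symm
  · exact hw h.symm

omit [Fintype E] [DecidableEq E] in
/-- **Connections between vertices other than the leaf do not see the leaf edge**: if `y'` agrees
with `y` off `e₁`, then `u ↔ v` in `y` implies `u ↔ v` in `y'` (`u, v ≠ o`). -/
lemma conn_of_leaf_agree {ends : E → Sym2 V} {a₂ o : V} {e₁ : E} (h₁ : ends e₁ = s(a₂, o))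
    (hleaf : ∀ e, o ∈ ends e → e = e₁) {y y' : Config E}
    (hagree : ∀ e, e ≠ e₁ → y' e = y e) {u v : V} (hu : u ≠ o) (hv : v ≠ o)
    (h : Conn ends y u v) : Conn ends y' u v := by
  let S : Set V := {z | (z ≠ o ∧ Conn ends y' u z) ∨ (z = o ∧ Conn ends y' u a₂)}
  have hS : v ∈ S := by
    refine mem_of_conn_of_closed (S := S) ?_ (Or.inl ⟨hu, conn_refl ends y' u⟩) h
    intro x hx w hxw
    obtain ⟨hne, e, he, hends⟩ := openGraph_adj.1 hxw
    rcases hx with ⟨hxo, hxc⟩ | ⟨hxo, hc⟩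
    · by_cases hwo : w = o
      · -- `w = o`: the edge is `e₁`, so `x = a₂`
        subst hwo
        have hx2 : x = a₂ := by
          have := endpoint_of_leaf h₁ hleaf (e := e) (w := x) (by rw [hends, Sym2.eq_swap]) hxo
          exact this.2
        exact Or.inr ⟨rfl, hx2 ▸ hxc⟩
      · have hne1 : e ≠ e₁ := ne_leafEdge h₁ hends hxo hwo
        have : y' e = true := by rw [hagree e hne1]; exact he
        exact Or.inl ⟨hwo, conn_trans hxc (conn_of_openAdj ⟨e, this, hends⟩)⟩
    · -- `x = o`: the edge is `e₁` and `w = a₂`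
      have hwo : w ≠ o := fun hw => hne (hxo.trans hw.symm)
      have hends' : ends e = s(o, w) := by rw [← hxo]; exact hends
      obtain ⟨_, hw2⟩ := endpoint_of_leaf h₁ hleaf hends' hwo
      refine Or.inl ⟨hwo, ?_⟩
      rw [hw2]; exact hc
  rcases hS with ⟨_, hc⟩ | ⟨hvo, _⟩
  · exact hc
  · exact absurd hvo hv

omit [Fintype E] [DecidableEq E] in
/-- `a₂ ↔ o` iff the leaf edge is open. -/
lemma conn_leaf_iff {ends : E → Sym2 V} {a₂ o : V} {e₁ : E} (h₁ : ends e₁ = s(a₂, o))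
    (hleaf : ∀ e, o ∈ ends e → e = e₁) (ho : o ≠ a₂) (y : Config E) :
    Conn ends y a₂ o ↔ y e₁ = true := by
  constructor
  · intro h
    by_contra hcl
    -- `o` is isolated when `e₁` is closed
    have hS : o ∈ ({z | z ≠ o} : Set V) := by
      refine mem_of_conn_of_closed (S := {z | z ≠ o}) ?_ (show a₂ ≠ o from ho.symm) h
      intro x hx w hxw hwo
      obtain ⟨_, e, he, hends⟩ := openGraph_adj.1 hxw
      subst hwo
      have he1 : e = e₁ := hleaf e (by rw [hends]; exact Sym2.mem_mk_right x w)
      subst he1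
      exact hcl he
    exact hS rfl
  · intro h
    exact conn_of_openAdj ⟨e₁, h, h₁⟩

variable {R : Type*} [Field R]

omit [Fintype E] [DecidableEq E] in
open Classical in
/-- `1_{b ∈ C₁}` as an `if`. -/
lemma iL_eq_ite (ends : E → Sym2 V) (a₁ b : V) (ω : Config E) :
    (iL ends a₁ b ω : R) = if Conn ends ω a₁ b then 1 else 0 := by
  by_cases h : Conn ends ω a₁ b
  · rw [if_pos h]; simp [iL, Set.indicator_of_mem (show ω ∈ connEvent ends a₁ b from h)]
  · rw [if_neg h]; simp [iL, Set.indicator_of_notMem (show ω ∉ connEvent ends a₁ b from h)]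

omit [Fintype E] [DecidableEq E] in
open Classical in
/-- Two configurations with equivalent connection events have the same `1_{b ∈ C₁}`. -/
lemma iL_congr {ends : E → Sym2 V} {a₁ b : V} {ω ω' : Config E}
    (h : Conn ends ω a₁ b ↔ Conn ends ω' a₁ b) : (iL ends a₁ b ω : R) = iL ends a₁ b ω' := by
  rw [iL_eq_ite, iL_eq_ite]
  by_cases hc : Conn ends ω a₁ b
  · rw [if_pos hc, if_pos (h.1 hc)]
  · rw [if_neg hc, if_neg (fun hc' => hc (h.2 hc'))]

omit [Fintype E] [DecidableEq E] in
open Classical in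
/-- Two configurations with equivalent connection events have the same `1_{o ∈ C₂}`. -/
lemma iH_congr {ends : E → Sym2 V} {a₂ o : V} {ω ω' : Config E}
    (h : Conn ends ω a₂ o ↔ Conn ends ω' a₂ o) : (iH ends a₂ o ω : R) = iH ends a₂ o ω' := by
  rw [iH_eq_ite, iH_eq_ite]
  by_cases hc : Conn ends ω a₂ o
  · rw [if_pos (show o ∈ cluster ends ω a₂ from hc), if_pos (show o ∈ cluster ends ω' a₂ from h.1 hc)]
  · rw [if_neg (show o ∉ cluster ends ω a₂ from hc),
      if_neg (show o ∉ cluster ends ω' a₂ from fun hc' => hc (h.2 hc'))]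

omit [Fintype E] [DecidableEq E] in
open Classical in
/-- Two configurations with equivalent `a₂ ↔ a₁` have the same `1_Q`. -/
lemma iQ_congr {ends : E → Sym2 V} {a₁ a₂ : V} {ω ω' : Config E}
    (h : Conn ends ω a₂ a₁ ↔ Conn ends ω' a₂ a₁) : (iQ ends a₁ a₂ ω : R) = iQ ends a₁ a₂ ω' := by
  rw [iQ_eq_ite, iQ_eq_ite]
  by_cases hc : Conn ends ω a₂ a₁
  · rw [if_pos (show a₁ ∈ cluster ends ω a₂ from hc), if_pos (show a₁ ∈ cluster ends ω' a₂ from h.1 hc)]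
  · rw [if_neg (show a₁ ∉ cluster ends ω a₂ from hc),
      if_neg (show a₁ ∉ cluster ends ω' a₂ from fun hc' => hc (h.2 hc'))]

omit [Fintype E] in
/-- The second copy of the single-edge flip is the single-edge flip of the second copy. -/
lemma flip_single_comm (F : Finset E) (e₁ : E) (y : Config E) :
    A3InactiveTyped.flipOn F (A3InactiveTyped.flipOn {e₁} y) =
      A3InactiveTyped.flipOn {e₁} (A3InactiveTyped.flipOn F y) := by
  funext e
  simp only [A3InactiveTyped.flipOn, Finset.mem_singleton]
  by_cases h1 : e = e₁ <;> by_cases hF : e ∈ F <;> simp [h1, hF] <;> split_ifs <;> simp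

/-- **Typed BHK 1.4 (single-vertex) with equality when `o` is a leaf at `a₂`**: if `ends e₁ = s(a₂, o)`
and `e₁` is the only edge at `o`, with `o ∉ {a₁, a₂, b}`, then `N(QAB, Q) = N(QB, QA)` at every profile. -/
theorem tb14_of_leaf (ends : E → Sym2 V) (a₁ a₂ b o : V) (F : Finset E) (z : Config E) (e₁ : E)
    (h₁ : ends e₁ = s(a₂, o)) (hleaf : ∀ e, o ∈ ends e → e = e₁) (ho2 : o ≠ a₂) (ho1 : o ≠ a₁)
    (hob : o ≠ b) :
    pairCount F z (sameBO ends a₁ a₂ b o : Config E → Config E → R) =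
      pairCount F z (crossBO ends a₁ a₂ b o) := by
  rw [← sub_eq_zero, pairCount_fold]
  unfold pairCount
  by_cases hF : e₁ ∈ F
  · -- flip `e₁`: an involution on all configurations
    let τ : Config E → Config E := A3InactiveTyped.flipOn {e₁}
    have hτ : ∀ y, τ (τ y) = y := fun y => A3InactiveTyped.flipOn_flipOn _ y
    have hagree : ∀ y e, e ≠ e₁ → τ y e = y e := by
      intro y e he
      simp [τ, A3InactiveTyped.flipOn, he]
    have hadm : ∀ y, (∀ e, e ∉ F → τ y e = z e) ↔ (∀ e, e ∉ F → y e = z e) := by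
      intro y
      constructor
      · intro h e he; rw [← hagree y e (fun h' => he (h' ▸ hF))]; exact h e he
      · intro h e he; rw [hagree y e (fun h' => he (h' ▸ hF))]; exact h e he
    -- the connection facts
    have hconn : ∀ (y : Config E) (u v : V), u ≠ o → v ≠ o → (Conn ends (τ y) u v ↔ Conn ends y u v) := by
      intro y u v hu hv
      constructor
      · intro h
        exact conn_of_leaf_agree h₁ hleaf (y := τ y) (y' := y)
          (fun e he => (hagree y e he).symm) hu hv h
      · exact conn_of_leaf_agree h₁ hleaf (hagree y) hu hv
    have hQ : ∀ y, (iQ ends a₁ a₂ (τ y) : R) = iQ ends a₁ a₂ y := fun y =>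
      iQ_congr (hconn y a₂ a₁ ho2.symm ho1.symm)
    have hA : ∀ y, (iL ends a₁ b (τ y) : R) = iL ends a₁ b y := fun y =>
      iL_congr (hconn y a₁ b ho1.symm hob.symm)
    have hB : ∀ y, (iH ends a₂ o (τ y) : R) = iH ends a₂ o (A3InactiveTyped.flipOn F y) := by
      intro y
      apply iH_congr
      rw [conn_leaf_iff h₁ hleaf ho2, conn_leaf_iff h₁ hleaf ho2]
      simp [τ, A3InactiveTyped.flipOn, hF]
    have hB' : ∀ y, (iH ends a₂ o (A3InactiveTyped.flipOn F (τ y)) : R) = iH ends a₂ o y := by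
      intro y
      rw [flip_single_comm]
      rw [hB (A3InactiveTyped.flipOn F y), A3InactiveTyped.flipOn_flipOn]
    have hQ' : ∀ y, (iQ ends a₁ a₂ (A3InactiveTyped.flipOn F (τ y)) : R) =
        iQ ends a₁ a₂ (A3InactiveTyped.flipOn F y) := by
      intro y; rw [flip_single_comm]; exact hQ _
    -- antisymmetry of the admissible summand
    refine Finset.sum_involution (fun y _ => τ y) ?_ ?_ ?_ ?_
    · intro y _
      simp only [hadm]
      split_ifs
      · simp only [foldBO, hQ, hA, hB, hB', hQ']
        ring
      · simp
    · intro y _ hne hfix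
      apply hne
      have : y e₁ = τ y e₁ := by rw [hfix]
      simp [τ, A3InactiveTyped.flipOn] at this
    · intro y _; exact Finset.mem_univ _
    · intro y _; exact hτ y
  · -- `e₁` pinned: `o ∈ C₂` agrees in both copies
    refine Finset.sum_eq_zero fun y _ => ?_
    split_ifs
    · simp only [foldBO]
      have : (iH ends a₂ o y : R) = iH ends a₂ o (A3InactiveTyped.flipOn F y) := by
        apply iH_congr
        rw [conn_leaf_iff h₁ hleaf ho2, conn_leaf_iff h₁ hleaf ho2]
        simp [A3InactiveTyped.flipOn, hF]
      rw [this]; ring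
    · rfl

end Leaf

end TB14Fold

end Summit.Ventures.PercRepro2
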